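import Summits.CriticalPhenomena.PercolationContinuityZ3.Theorems.PercNearOneGluingNoHeavyLowerTailEGRelayGluing
import HarnessLib

/-!
# `NoHeavyLowerTail` (stmt-CriticalPhenomena-4575) — EVENT-GLUING one-Steiner step (every most-detached relay as witness)

Support file (prover `prim-hp-2`, deletion–contraction line; `--supports stmt-CriticalPhenomena-4575`).  No definitions, no named
facts, no sorries.  Notation as in `…EGRelayGluing.lean`: sink `b ≠ o`, `EG-L_v = {v ↔ A} ∩ {v ↮ b}`, `EG-R_a = {a ↮ b}`,
"most detached" = maximiser of `μ(EG-R_·)` over `A`.  Event-gluing copy of `…CILOneSteiner` (prim-gen-swap): the level-`j`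
events are replaced by the detachment events and `CILOneSteiner.mergeStability_at_relay` by `EGTransfer.mergeStability_at_relay`.

* `EGTransfer.eg_oneSteiner_of` — the MODULAR step: event gluing at `x` in `G − o` (every most-detached relay) ⇒ event gluing at
  `o` in `G` (every most-detached relay), when the positive-weight neighbours of `o` are relays and possibly the one vertex `x`;
* `EGTransfer.eg_oneSteiner` — discharged by `EGTransfer.eg_of_relayNeighbours` when the other positive-weight neighbours of `x`
  are relays: **`μ(o ↔ A, o ↮ b) ≤ μ(c ↮ b)` for every most-detached relay `c`** (Kozma–Nitzan Theorem 5's configuration; on a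
  uniform star sink this is sharp GM-CIL(1) with every GM-champion).
-/

noncomputable section

namespace Summit.CriticalPhenomena.PercolationContinuityZ3.Theorems

open MeasureTheory Set Literature.Probability.LatticeModels Literature.Probability.Percolation
open scoped Classical BigOperators

namespace EGTransfer

variable {n : ℕ}

open CILOneSteiner ChampionStability MergeStability RelayNbhd

/-- **Modular one-Steiner step, event-gluing form** (cf. `cil_oneSteiner_of`; [KozmaNitzan2024, Thm 5]): if the positive-
weight neighbours of `o` are relays and possibly one further vertex `x ∉ A`, and in `G − o` event gluing holds at the observer
`x` with every most-detached relay of `G − o` as witness, then `μ(o ↔ A, o ↮ b) ≤ μ(c ↮ b)` holds at `o` in `G` for every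
most-detached relay `c` of `G` (`b ≠ o` a fixed sink).
[cite: KozmaNitzan2024, Thm 5 (p. 13) — event-gluing analogue; VandenbergHaggstromKahn2005, Thm. 1.5 (p. 7)] -/
theorem eg_oneSteiner_of (A : Finset (Fin n)) (o x b : Fin n) (ho : o ∉ A) (hx : x ∉ A) (hxo : x ≠ o) (hbo : b ≠ o) :
    ∀ (m : ℕ) (w : Sym2 (Fin n) → unitInterval),
      (A.filter fun v => 0 < (w s(o, v) : ℝ)).card = m →
      (∀ v : Fin n, v ≠ o → v ∉ A → v ≠ x → (w s(o, v) : ℝ) = 0) →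
      (∀ c' ∈ A, (∀ a ∈ A,
        (prodBernoulli (pinW w {e : Sym2 (Fin n) | o ∈ e ∧ ¬ e.IsDiag} ∅)).real
            {ω : BondConfig (Fin n) | ω ∉ openConn a b} ≤
          (prodBernoulli (pinW w {e : Sym2 (Fin n) | o ∈ e ∧ ¬ e.IsDiag} ∅)).real
            {ω : BondConfig (Fin n) | ω ∉ openConn c' b}) →
        (prodBernoulli (pinW w {e : Sym2 (Fin n) | o ∈ e ∧ ¬ e.IsDiag} ∅)).real {ω : BondConfig (Fin n) |
            (∃ a ∈ A, ω ∈ openConn x a) ∧ ω ∉ openConn x b} ≤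
          (prodBernoulli (pinW w {e : Sym2 (Fin n) | o ∈ e ∧ ¬ e.IsDiag} ∅)).real
            {ω : BondConfig (Fin n) | ω ∉ openConn c' b}) →
      ∀ c ∈ A, (∀ a ∈ A,
        (prodBernoulli w).real {ω : BondConfig (Fin n) | ω ∉ openConn a b} ≤
          (prodBernoulli w).real {ω : BondConfig (Fin n) | ω ∉ openConn c b}) →
      (prodBernoulli w).real {ω : BondConfig (Fin n) |
          (∃ a ∈ A, ω ∈ openConn o a) ∧ ω ∉ openConn o b} ≤
        (prodBernoulli w).real {ω : BondConfig (Fin n) | ω ∉ openConn c b} := by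
  intro m
  induction m with
  | zero =>
    intro w hm hoN hH c hc hchampw
    -- no relay pair at `o`: only `s(o,x)` may be positive
    have hrel0 : ∀ v ∈ A, (w s(o, v) : ℝ) = 0 := by
      intro v hv
      by_contra hne
      have hpos : 0 < (w s(o, v) : ℝ) := lt_of_le_of_ne (w s(o, v)).2.1 (Ne.symm hne)
      have hmem : v ∈ (A.filter fun v => 0 < (w s(o, v) : ℝ)) := Finset.mem_filter.2 ⟨hv, hpos⟩
      rw [Finset.card_eq_zero] at hm
      rw [hm] at hmem
      exact Finset.notMem_empty v hmem
    set e : Sym2 (Fin n) := s(o, x) with he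
    set w₀ : Sym2 (Fin n) → unitInterval := Function.update w e 0 with hw₀
    set w₁ : Sym2 (Fin n) → unitInterval := Function.update w e 1 with hw₁
    set μ₀ := prodBernoulli w₀ with hμ₀
    -- under `w₀`, `o` is isolated
    have hiso₀ : ∀ v : Fin n, v ≠ o → (w₀ s(o, v) : ℝ) = 0 := by
      intro v hv
      by_cases hvx : v = x
      · subst hvx; simp [hw₀, he]
      · by_cases hvA : v ∈ A
        · exact update_zero_apply_eq_zero w e _ (hrel0 v hvA)
        · exact update_zero_apply_eq_zero w e _ (hoN v hv hvA hvx)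
    -- `w₀` IS the graph `G − o`
    have hw₀pin : w₀ = pinW w {e : Sym2 (Fin n) | o ∈ e ∧ ¬ e.IsDiag} ∅ := by
      funext e'
      by_cases hmem : e' ∈ {e : Sym2 (Fin n) | o ∈ e ∧ ¬ e.IsDiag}
      · obtain ⟨hoe, hdiag⟩ := hmem
        obtain ⟨v, rfl⟩ : ∃ v, e' = s(o, v) := by
          induction e' using Sym2.ind with
          | h a b =>
            rcases Sym2.mem_iff.1 hoe with rfl | rfl
            · exact ⟨b, rfl⟩
            · exact ⟨a, Sym2.eq_swap⟩
        have hvo : v ≠ o := by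
          intro h; apply hdiag; rw [h]; exact Sym2.mk_isDiag_iff.2 rfl
        rw [pinW_star_mk w hvo]
        exact Subtype.ext (hiso₀ v hvo)
      · rw [pinW_apply_of_not_mem w ∅ hmem]
        have hne : e' ≠ e := by
          rw [he]; intro h; apply hmem; rw [h]
          exact ⟨Sym2.mem_mk_left o x, by rw [Sym2.mk_isDiag_iff]; exact hxo.symm⟩
        rw [hw₀, Function.update_of_ne hne]
    -- a champion `c₀` of `w₀`; CIL for the observer `x` under `w₀` (hypothesis)
    obtain ⟨c₀, hc₀, hchamp₀⟩ := exists_mostDetached μ₀ A ⟨c, hc⟩ b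
    have hLx : μ₀.real {ω : BondConfig (Fin n) |
        (∃ a ∈ A, ω ∈ openConn x a) ∧ ω ∉ openConn x b} ≤
        μ₀.real {ω : BondConfig (Fin n) | ω ∉ openConn c₀ b} := by
      have H := hH c₀ hc₀
      rw [← hw₀pin] at H
      exact H hchamp₀
    -- the `o`-isolation event has full `μ₀`-measure
    set F := (Finset.univ.filter fun v : Fin n => v ≠ o).image (fun v => s(o, v)) with hF
    set Bad : Set (BondConfig (Fin n)) := {ω | ∃ e' ∈ F, e' ∈ ω} with hBad
    have hBad0 : μ₀.real Bad = 0 := by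
      have hzero : μ₀ Bad = 0 := by
        refine prodBernoulli_setOf_exists_mem_eq_zero w₀ F fun e' he' => ?_
        obtain ⟨v, hv, rfl⟩ := Finset.mem_image.1 he'
        exact hiso₀ v (Finset.mem_filter.1 hv).2
      rw [measureReal_def, hzero, ENNReal.toReal_zero]
    have hisoω : ∀ ω : BondConfig (Fin n), ω ∉ Bad → ∀ v : Fin n, v ≠ o → s(o, v) ∉ ω := by
      intro ω hω v hv hmem
      exact hω ⟨s(o, v), Finset.mem_image.2 ⟨v, Finset.mem_filter.2 ⟨Finset.mem_univ _, hv⟩, rfl⟩, hmem⟩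
    have hmeas : ∀ S : Set (BondConfig (Fin n)), MeasurableSet S := fun S => (Set.toFinite S).measurableSet
    -- (d) `μ₁(L_o) ≤ μ₀(L_x)`
    have hw₀e : w₀ s(o, x) = 0 := by simp [hw₀, he]
    have hw₁eq : Function.update w₀ s(o, x) 1 = w₁ := by rw [hw₀, hw₁, he, Function.update_idem]
    have hLo : (prodBernoulli w₁).real {ω : BondConfig (Fin n) |
        (∃ a ∈ A, ω ∈ openConn o a) ∧ ω ∉ openConn o b} ≤
        μ₀.real {ω : BondConfig (Fin n) |
          (∃ a ∈ A, ω ∈ openConn x a) ∧ ω ∉ openConn x b} := by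
      rw [← hw₁eq, real_update_one_eq w₀ hw₀e]
      have hsub : ((fun ω : BondConfig (Fin n) => insert s(o, x) ω) ⁻¹' {ω : BondConfig (Fin n) |
          (∃ a ∈ A, ω ∈ openConn o a) ∧ ω ∉ openConn o b}) ⊆
          {ω : BondConfig (Fin n) | (∃ a ∈ A, ω ∈ openConn x a) ∧
            ω ∉ openConn x b} ∪ Bad := by
        intro ω hω
        by_cases hB : ω ∈ Bad
        · exact Or.inr hB
        · left
          simp only [mem_preimage, mem_setOf_eq] at hω ⊢
          obtain ⟨⟨a, ha, hoa⟩, hob⟩ := hω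
          have hao : a ≠ o := fun h => ho (h ▸ ha)
          have hoa' : (openGraph (insert s(o, x) ω)).Reachable o a := hoa
          refine ⟨⟨a, ha, (reachable_o_insert_iff_of_isolated (Ne.symm hxo) (hisoω ω hB) hao).1 hoa'⟩,
            fun hxb => hob ?_⟩
          have hxb' : (openGraph ω).Reachable x b := hxb
          exact (reachable_o_insert_iff_of_isolated (Ne.symm hxo) (hisoω ω hB) hbo).2 hxb'
      calc μ₀.real _ ≤ μ₀.real ({ω : BondConfig (Fin n) | (∃ a ∈ A, ω ∈ openConn x a) ∧
              ω ∉ openConn x b} ∪ Bad) := measureReal_mono hsub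
        _ ≤ μ₀.real {ω : BondConfig (Fin n) | (∃ a ∈ A, ω ∈ openConn x a) ∧
              ω ∉ openConn x b} + μ₀.real Bad := measureReal_union_le _ _
        _ = _ := by rw [hBad0, add_zero]
    -- (f) `μ₀(R_{c₀}) ≤ μ₁(R_{c₀})`
    have hRc : μ₀.real {ω : BondConfig (Fin n) | ω ∉ openConn c₀ b} ≤
        (prodBernoulli w₁).real {ω : BondConfig (Fin n) | ω ∉ openConn c₀ b} := by
      rw [← hw₁eq, real_update_one_eq w₀ hw₀e]
      set R : Set (BondConfig (Fin n)) := {ω | ω ∉ openConn c₀ b} with hR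
      have hsub : R \ Bad ⊆ (fun ω : BondConfig (Fin n) => insert s(o, x) ω) ⁻¹' R := by
        intro ω hω
        obtain ⟨hωR, hB⟩ := hω
        simp only [hR, mem_preimage, mem_setOf_eq] at hωR ⊢
        have hc₀o : c₀ ≠ o := fun h => ho (h ▸ hc₀)
        intro h
        apply hωR
        have h' : (openGraph (insert s(o, x) ω)).Reachable c₀ b := h
        show (openGraph ω).Reachable c₀ b
        rcases (reachable_insert_iff_of_isolated (Ne.symm hxo) (hisoω ω hB) hc₀o hbo).1 h' with h1 | ⟨h1, h2⟩
        · exact h1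
        · exact h1.trans h2
      have hsplit : μ₀.real (R ∩ Bad) + μ₀.real (R \ Bad) = μ₀.real R :=
        measureReal_inter_add_sdiff (hmeas Bad) (measure_ne_top _ _)
      have hRB : μ₀.real (R ∩ Bad) = 0 :=
        le_antisymm ((measureReal_mono inter_subset_right).trans hBad0.le) measureReal_nonneg
      calc μ₀.real R = μ₀.real (R \ Bad) := by linarith
        _ ≤ _ := measureReal_mono hsub
    -- (b) `μ₀(L_o) = 0` and (g) assembly through the one-bond decomposition
    have hL0 := real_EGL_eq_zero_of_isolated w₀ A o b ho hiso₀
    have hRcc : (prodBernoulli w).real {ω : BondConfig (Fin n) | ω ∉ openConn c₀ b} ≤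
        (prodBernoulli w).real {ω : BondConfig (Fin n) | ω ∉ openConn c b} :=
      hchampw c₀ hc₀
    refine le_trans ?_ hRcc
    have hp0 : 0 ≤ (w e : ℝ) := (w e).2.1
    have hp1 : (w e : ℝ) ≤ 1 := (w e).2.2
    rw [stub_oneBondDecomp_k15 n w e {ω : BondConfig (Fin n) |
        (∃ a ∈ A, ω ∈ openConn o a) ∧ ω ∉ openConn o b},
      stub_oneBondDecomp_k15 n w e {ω : BondConfig (Fin n) |
        ω ∉ openConn c₀ b}]
    rw [← hw₀, ← hw₁, ← hμ₀] at *
    rw [hL0, mul_zero, zero_add]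
    have h1 : (w e : ℝ) * (prodBernoulli w₁).real {ω : BondConfig (Fin n) |
          (∃ a ∈ A, ω ∈ openConn o a) ∧ ω ∉ openConn o b} ≤
        (w e : ℝ) * (prodBernoulli w₁).real {ω : BondConfig (Fin n) |
          ω ∉ openConn c₀ b} :=
      mul_le_mul_of_nonneg_left (hLo.trans (hLx.trans hRc)) hp0
    have h0 : 0 ≤ (1 - (w e : ℝ)) * μ₀.real {ω : BondConfig (Fin n) |
          ω ∉ openConn c₀ b} :=
      mul_nonneg (by linarith) measureReal_nonneg
    linarith
  | succ m ih =>
    intro w hm hoN hH c hc hchampw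
    obtain ⟨v, hv⟩ := Finset.card_pos.1 (by omega : 0 < (A.filter fun v => 0 < (w s(o, v) : ℝ)).card)
    obtain ⟨hvA, hvpos⟩ := Finset.mem_filter.1 hv
    have hvo : v ≠ o := fun h => ho (h ▸ hvA)
    have hvx : v ≠ x := fun h => hx (h ▸ hvA)
    set e : Sym2 (Fin n) := s(o, v) with he
    set w₀ : Sym2 (Fin n) → unitInterval := Function.update w e 0 with hw₀
    set w₁ : Sym2 (Fin n) → unitInterval := Function.update w e 1 with hw₁
    have hcount : (A.filter fun u => 0 < (w₀ s(o, u) : ℝ)).card = m := by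
      have hset : (A.filter fun u => 0 < (w₀ s(o, u) : ℝ)) = (A.filter fun u => 0 < (w s(o, u) : ℝ)).erase v := by
        ext u
        simp only [Finset.mem_filter, Finset.mem_erase]
        by_cases huv : u = v
        · subst huv
          simp [hw₀, he, hvA]
        · have hne : s(o, u) ≠ e := by
            rw [he]
            intro h
            exact huv (Sym2.congr_right.1 h)
          simp [hw₀, Function.update_of_ne hne, huv]
      rw [hset, Finset.card_erase_of_mem hv, hm]
      rfl
    have hoN₀ : ∀ u : Fin n, u ≠ o → u ∉ A → u ≠ x → (w₀ s(o, u) : ℝ) = 0 :=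
      fun u hu huA hux => update_zero_apply_eq_zero w e _ (hoN u hu huA hux)
    have hH₀ := hH
    rw [← pinW_star_update w hvo (0 : unitInterval)] at hH₀
    obtain ⟨c₀, hc₀, hchamp₀⟩ := exists_mostDetached (prodBernoulli w₀) A ⟨c, hc⟩ b
    have hL₀ := ih w₀ hcount hoN₀ hH₀ c₀ hc₀ hchamp₀
    have hw₀e : w₀ s(o, v) = 0 := by simp [hw₀, he]
    have hMS := EGTransfer.mergeStability_at_relay w₀ A o v c₀ b ho hvA hw₀e hchamp₀
    have hw₁eq : Function.update w₀ s(o, v) 1 = w₁ := by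
      rw [hw₀, hw₁, he, Function.update_idem]
    rw [hw₁eq] at hMS
    have hp0 : 0 ≤ (w e : ℝ) := (w e).2.1
    have hp1 : (w e : ℝ) ≤ 1 := (w e).2.2
    have hRc : (prodBernoulli w).real {ω : BondConfig (Fin n) | ω ∉ openConn c₀ b} ≤
        (prodBernoulli w).real {ω : BondConfig (Fin n) | ω ∉ openConn c b} :=
      hchampw c₀ hc₀
    refine le_trans ?_ hRc
    rw [stub_oneBondDecomp_k15 n w e {ω : BondConfig (Fin n) |
        (∃ a ∈ A, ω ∈ openConn o a) ∧ ω ∉ openConn o b},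
      stub_oneBondDecomp_k15 n w e {ω : BondConfig (Fin n) |
        ω ∉ openConn c₀ b}]
    have h0 : (1 - (w e : ℝ)) * (prodBernoulli w₀).real {ω : BondConfig (Fin n) |
          (∃ a ∈ A, ω ∈ openConn o a) ∧ ω ∉ openConn o b} ≤
        (1 - (w e : ℝ)) * (prodBernoulli w₀).real {ω : BondConfig (Fin n) |
          ω ∉ openConn c₀ b} :=
      mul_le_mul_of_nonneg_left hL₀ (by linarith)
    have h1 : (w e : ℝ) * (prodBernoulli w₁).real {ω : BondConfig (Fin n) |
          (∃ a ∈ A, ω ∈ openConn o a) ∧ ω ∉ openConn o b} ≤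
        (w e : ℝ) * (prodBernoulli w₁).real {ω : BondConfig (Fin n) |
          ω ∉ openConn c₀ b} :=
      mul_le_mul_of_nonneg_left hMS hp0
    exact add_le_add h0 h1


/-- **Event gluing (every most-detached relay as witness) for an observer with relay neighbours and ONE Steiner neighbour
`x` whose other positive-weight neighbours are relays**: `μ(o ↔ A, o ↮ b) ≤ μ(c ↮ b)` for every most-detached `c ∈ A`
(`b ≠ o`).  [cite: KozmaNitzan2024, Thm 5 (p. 13) — event-gluing analogue with every witness] -/
theorem eg_oneSteiner (w : Sym2 (Fin n) → unitInterval) (A : Finset (Fin n)) (o x b : Fin n)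
    (ho : o ∉ A) (hx : x ∉ A) (hxo : x ≠ o) (hbo : b ≠ o)
    (hoN : ∀ v : Fin n, v ≠ o → v ∉ A → v ≠ x → (w s(o, v) : ℝ) = 0)
    (hxN : ∀ u : Fin n, u ≠ x → u ∉ A → u ≠ o → (w s(x, u) : ℝ) = 0)
    (c : Fin n) (hc : c ∈ A)
    (hdet : ∀ a ∈ A,
      (prodBernoulli w).real {ω : BondConfig (Fin n) | ω ∉ openConn a b} ≤
        (prodBernoulli w).real {ω : BondConfig (Fin n) | ω ∉ openConn c b}) :
    (prodBernoulli w).real {ω : BondConfig (Fin n) | (∃ a ∈ A, ω ∈ openConn o a) ∧ ω ∉ openConn o b} ≤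
      (prodBernoulli w).real {ω : BondConfig (Fin n) | ω ∉ openConn c b} := by
  refine eg_oneSteiner_of A o x b ho hx hxo hbo _ w rfl hoN ?_ c hc hdet
  intro c' hc' hdet'
  refine eg_of_relayNeighbours A x b hx _ _ rfl ?_ c' hc' hdet'
  intro u hu huA
  by_cases huo : u = o
  · subst huo
    rw [Sym2.eq_swap, pinW_star_mk w hxo]
    rfl
  · have hmem : s(x, u) ∉ {e : Sym2 (Fin n) | o ∈ e ∧ ¬ e.IsDiag} := by
      rintro ⟨hoe, -⟩
      rcases Sym2.mem_iff.1 hoe with h | h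
      · exact hxo h.symm
      · exact huo h.symm
    rw [pinW_apply_of_not_mem w ∅ hmem]
    exact hxN u hu huA huo

end EGTransfer

end Summit.CriticalPhenomena.PercolationContinuityZ3.Theorems

end
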